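import Literature.AlgebraicGeometry.AbelianSchemes.AbelianSchemeQuotientDualPairDivision
import Literature.AlgebraicGeometry.AbelianSchemes.AbelianSchemeQuotientDualPairRigidified
import Literature.AlgebraicGeometry.AbelianSchemes.AbelianSchemeQuotientBaseChangeAction
import Literature.AlgebraicGeometry.AbelianSchemes.AbelianSchemeQuotientDescentCharacter
import Literature.AlgebraicGeometry.AbelianSchemes.DualPairUniqueOfStabilizer
import Literature.AlgebraicGeometry.RelativeSpec.PullbackIsoDiscrepancyJunctions
import HarnessLib

/-!
# The `K`-discrepancy units of the division step and the open pieces where they die (HECKE-LINK H2, D6 (u1)+(u2), part 2)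

Layer `Literature/AlgebraicGeometry/AbelianSchemes`, namespace `Literature.AlgebraicGeometry.AbelianSchemes.AbelianSchemeOver`.
THEOREMS ONLY; no definition, no named fact, no instance, no notation, no `sorry`.

Setting of ★ `AbelianSchemeQuotientDualPairDivision` (part 1): `ψ : A → B := A/K` (★ `quotientMk`, a free `K`-quotient; base changes
`ψ_{T} = ψ ▷ T` ★ (u0) `translationActionOverWhiskerRight`), `𝒩₁ = (π × 1)^*𝒫` on `B ×_S Â`, `B̂ := Â/K′`, `𝒫_B^{rig}` (★ (ii) part 3).
[MumfordAV1970] §15 Thm. 1: after the `[n]`-division, `ψ_{T₁}^*((1 × a₁)^*𝒩₁) ≅ ψ_{T₁}^*(ℒ|)` (★ `nonempty_pullback_division_iso`) and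
the two modules on `B_{T₁}` differ by their `K`-descent data, measured by the DISCREPANCY of ★ `RelativeSpec/PullbackIsoDiscrepancy`.

* §1 plumbing: `whiskerRight_left_comp_prodMap` (`(v ▷ T₁) ≫ (1 × w) = (1 × w) ≫ (v ▷ T₂)`), `prodMap_comp_baseChange_hom`,
  `whiskerRight_left_comp_baseChange_hom` (+ private: units on basic opens, roots of unity with invertible geometric sum);
* §2 **`nonempty_pullback_poincareQuotRigid_iso_of_pullback_poincarePullback_iso`** — reduction `Â/K′ ⇝ Â`: a module which is
  `(1 × a₁)^*𝒩₁` is `(1 × (a₁ ≫ ψ̂))^*𝒫_B^{rig}` (★ ePB `nonempty_pullback_whiskerLeft_poincareQuotRigid_iso`);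
* §3 **`exists_discrepancy_hom`** — the discrepancy UNITS `v : K →* Γ(T₁, 𝒪)` of `e : ψ_{T₁}^*F₁ ≅ ψ_{T₁}^*F₀` (STEIN for `A`,
  hypothesis `hSteinA`; `(v σ)ⁿ = 1`), and **`nonempty_pullback_prodMap_iso_on_basicOpen`** — on the open piece
  `G = D(∏_σ Σ_{i<n} (v σ)^i)` of `T₁` the two modules agree: `F₁|_{B_G} ≅ F₀|_{B_G}`.
Part 3 (`AbelianSchemeQuotientDualPairLevelTwist`): the pieces attached to the level twists `a·φ̂(c)` cover `T₁`; part 4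
(`AbelianSchemeQuotientDualPairExistsLocal`): gluing and the fpqc-local existence head.

Cell `hodgecm-mathlib`, HECKE-LINK socket (B) file (ii), D6 brick (u1)+(u2) «EXISTENCE half of the universal property of the dual
pair of `A/K`» (B-plan1 (g14) 2026-08-29; design review B-p20 (g9); generic engine ★ `RelativeSpec/PullbackIsoDiscrepancy`, B-p07 (g14)).
HC_CM is proved only modulo the 7 printed citations until rung 0 closes; nothing here is about HC.

## References
* [MumfordAV1970] D. Mumford, *Abelian Varieties* (1970), §7 Thm. 4 (p. 72), §12 Thm. 1 (p. 112), §15 Thm. 1 (p. 143).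
* [MilneAV2008] J. S. Milne, *Abelian Varieties* (2008), I §8 (pp. 36–37), I §9 Thm. 9.1 (p. 42).
* [MumfordFogartyKirwan1994] D. Mumford, J. Fogarty, F. Kirwan, *GIT*, 3rd ed., Ch. 1 §3 Def. 1.6 (p. 30), Ch. 7 §2 Def. 7.1 (p. 129).
* [Greither1992CyclicGalois] C. Greither, LNM 1534 (1992), Ch. 0 Prop. 7.2 (p. 29).
* [GortzWedhorn2020] U. Görtz, T. Wedhorn, *Algebraic Geometry I*, 2nd ed. (2020), Section (4.7), Thm. 14.72.
-/

noncomputable section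

-- `(A.baseChange f).X = (Over.pullback f).obj A.X` / `(A.X ⊗ B.X).left = A.prodLeft B` hold by `rfl` only.
set_option backward.isDefEq.respectTransparency false

universe u

open CategoryTheory CategoryTheory.Limits AlgebraicGeometry MonoidalCategory CartesianMonoidalCategory
open scoped MonObj

namespace Literature.AlgebraicGeometry.AbelianSchemes

namespace AbelianSchemeOver

open Literature.AlgebraicGeometry.RelativeSpec Literature.AlgebraicGeometry.AbelianVarieties
  Literature.AlgebraicGeometry.Motives Literature.AlgebraicGeometry.Modules

/-! ## §1 Plumbing: whiskered homomorphisms against `prodMap`, basic opens -/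

section Plumbing

variable {S : Scheme.{u}} (A B : AbelianSchemeOver S)

/-- **`(v ▷ T₁) ≫ (1_B × w) = (1_A × w) ≫ (v ▷ T₂)`** for an `S`-morphism `v : A → B` and `w : T₁ → T₂` with `w ≫ f₂ = f₁` — the
base change of a homomorphism commutes with restriction of the base (both composites are `(pr_A ≫ v, pr_T ≫ w)`).
[cite: GortzWedhorn2020, Section (4.7) (pp. 107–108)] -/
@[reassoc]
theorem whiskerRight_left_comp_prodMap {T₁ T₂ : Scheme.{u}} (f₁ : T₁ ⟶ S) (f₂ : T₂ ⟶ S) (w : T₁ ⟶ T₂) (hw : w ≫ f₂ = f₁)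
    (v : A.X ⟶ B.X) :
    (v ▷ Over.mk f₁).left ≫ B.prodMap f₁ f₂ w hw = A.prodMap f₁ f₂ w hw ≫ (v ▷ Over.mk f₂).left := by
  have h1 : (baseChangeHom v f₁).left = (v ▷ Over.mk f₁).left := A.baseChangeHom_left_eq_whiskerRight_left' B (Over.mk f₁) v
  have h2 : (baseChangeHom v f₂).left = (v ▷ Over.mk f₂).left := A.baseChangeHom_left_eq_whiskerRight_left' B (Over.mk f₂) v
  subst hw
  have h3 : (baseChangeHom v (w ≫ f₂)).left ≫ B.restrictLeft f₂ w = A.restrictLeft f₂ w ≫ (baseChangeHom v f₂).left :=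
    (A.restrictLeft_comp_baseChangeHom_left B f₂ w v).symm
  rw [A.restrictLeft_eq_prodMap, B.restrictLeft_eq_prodMap, h1, h2] at h3
  exact h3

/-- `(1_A × w) ≫ pr_{T₂} = pr_{T₁} ≫ w` with the projections spelled as the structure maps `(A.baseChange fᵢ).X.hom`.
[cite: GortzWedhorn2020, Section (4.7) (pp. 107–108)] -/
@[reassoc]
theorem prodMap_comp_baseChange_hom {T₁ T₂ : Scheme.{u}} (f₁ : T₁ ⟶ S) (f₂ : T₂ ⟶ S) (w : T₁ ⟶ T₂) (hw : w ≫ f₂ = f₁) :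
    A.prodMap f₁ f₂ w hw ≫ (A.baseChange f₂).X.hom = (A.baseChange f₁).X.hom ≫ w :=
  A.prodMap_snd f₁ f₂ w hw

/-- `(t ▷ T′) ≫ pr_{T′} = pr_{T′}` with the projection spelled as the structure map `(A.baseChange f).X.hom` (`T′ = Over.mk f`).
[cite: GortzWedhorn2020, Section (4.7) (pp. 107–108)] -/
@[reassoc]
theorem whiskerRight_left_comp_baseChange_hom {T : Scheme.{u}} (f : T ⟶ S) (t : A.X ⟶ A.X) :
    (t ▷ Over.mk f).left ≫ (A.baseChange f).X.hom = (A.baseChange f).X.hom :=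
  Over.whiskerRight_left_snd _

/-- On the basic open `D(r)` the function `r` becomes a unit: `IsUnit (D(r).ι^♯ r)`. [folklore] -/
private theorem isUnit_basicOpen_ι_appTop (X : Scheme.{u}) (r : Γ(X, ⊤)) : IsUnit ((X.basicOpen r).ι.appTop r) := by
  have h := RingedSpace.isUnit_res_basicOpen (X := X.toLocallyRingedSpace.toRingedSpace) (U := ⊤) r
  have hle : (X.basicOpen r).ι ''ᵁ ⊤ ≤ X.basicOpen r := le_of_eq (Scheme.Opens.ι_image_top _)
  have hfac : (X.basicOpen r).ι.appTop r =
      X.presheaf.map (homOfLE hle).op (X.presheaf.map (homOfLE (X.basicOpen_le r)).op r) := by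
    rw [Scheme.Opens.ι_appTop, ← CommRingCat.comp_apply, ← X.presheaf.map_comp]
    rfl
  rw [hfac]
  exact h.map _

/-- A unit `u` with `uⁿ = 1` EQUALS `1` wherever `1 + u + ⋯ + u^{n-1}` is invertible (`(u - 1)(1 + u + ⋯ + u^{n-1}) = uⁿ - 1 = 0`).
[folklore] -/
private theorem eq_one_of_pow_eq_one_of_isUnit_geomSum {R : Type*} [CommRing R] {x : R} {n : ℕ} (hx : x ^ n = 1)
    (hu : IsUnit (∑ i ∈ Finset.range n, x ^ i)) : x = 1 := by
  have h : (x - 1) * ∑ i ∈ Finset.range n, x ^ i = 0 := by rw [mul_geom_sum, hx, sub_self]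
  exact sub_eq_zero.mp (hu.mul_left_eq_zero.mp h)

end Plumbing

/-! ## §2 The setting of the dual pair of `A/K`; reduction from `Â/K′` to `Â` -/

section Quotient

variable {S : Scheme.{u}} (A : AbelianSchemeOver S)
  {Y : Scheme.{u}} (u : S ⟶ Y) (K : Subgroup A.Sections) [IsCommMonObj A.X] {n : ℕ}
  (hK : ∀ σ : K, (σ : A.Sections) ^ n = 1)
  [Finite K] [Y.IsSeparated] [IsSeparated (A.X.hom ≫ u)] [S.IsSeparated]
  (hcov : ∀ x : A.left, ∃ O : (A.translationActionOver u K).StableAffineOpens, x ∈ O.1)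
  [LocallyOfFiniteType (A.X.hom ≫ u)] [IsLocallyNoetherian Y]
  (hG : ∃ _ : GrpObj (A.quotientOver u K), IsMonHom (A.quotientMk u K hcov))
  (hsm : Smooth (A.quotientOver u K).hom) (hgc : GeometricallyConnected (A.quotientOver u K).hom)
  (D : A.DualPair) [IsAffine Y]
  (hfree : ∀ (Ω : Type u) [Field Ω] [IsAlgClosed Ω] (x : Spec (.of Ω) ⟶ A.left) (σ : K), σ ≠ 1 →
    x ≫ (A.translation (σ : A.Sections)).left ≠ x)

variable
  -- the dual side: a finite subgroup `K′ ≤ Â(S)` with the file-(i) hypotheses for `(Â, K′)`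
  (K' : Subgroup D.hat.Sections) [Finite K'] [IsSeparated (D.hat.X.hom ≫ u)]
  (hcov' : ∀ x : D.hat.left, ∃ O : (D.hat.translationActionOver u K').StableAffineOpens, x ∈ O.1)
  [LocallyOfFiniteType (D.hat.X.hom ≫ u)]
  (hG' : ∃ _ : GrpObj (D.hat.quotientOver u K'), IsMonHom (D.hat.quotientMk u K' hcov'))
  (hsm' : Smooth (D.hat.quotientOver u K').hom) (hgc' : GeometricallyConnected (D.hat.quotientOver u K').hom)
  (hfree' : ∀ (Ω : Type u) [Field Ω] [IsAlgClosed Ω] (x : Spec (.of Ω) ⟶ D.hat.left) (σ : K'), σ ≠ 1 →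
    x ≫ (D.hat.translation (σ : D.hat.Sections)).left ≠ x)
  -- D3b's output: a `K′`-equivariant structure on `𝒩₁` for the D3a action
  (Φ : (prodTranslationActionOver (A.quotientBy u K hcov hG hsm hgc) D.hat u K' hcov').EquivariantStructure
    (A.poincarePullback u K hK hcov hG hsm hgc D hfree))

include hfree' in
/-- **Reduction to `Â`**: if a module `L₁` on `B_{T₁}` (`B := A/K`) is `(1_B × a₁)^* 𝒩₁` for a `T₁`-valued point `a₁` of `Â`, then it
is `(1_B × g₁)^* 𝒫_B^{rig}` for the `T₁`-valued point `g₁ := a₁ ≫ ψ̂` of `Â/K′` (★ `nonempty_pullback_whiskerLeft_poincareQuotRigid_iso`: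
`(B ◁ ψ̂)^*𝒫_B^{rig} ≅ 𝒩₁`, and `(1 × a₁)^*(B ◁ ψ̂)^* = (1 × (a₁ ≫ ψ̂))^*`, ★ `nonempty_pullback_baseChangeToProd_pullback_whiskerLeft_iso`).
[cite: MumfordAV1970, §15 Thm. 1 (p. 143)] [cite: MilneAV2008, I §8 (pp. 36–37)] -/
theorem nonempty_pullback_poincareQuotRigid_iso_of_pullback_poincarePullback_iso {T₁ : Scheme.{u}} (f₁ : T₁ ⟶ S)
    (a₁ : T₁ ⟶ D.hat.X.left) (ha₁ : a₁ ≫ D.hat.X.hom = f₁)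
    (L₁ : ((A.quotientBy u K hcov hG hsm hgc).baseChange f₁).X.left.Modules)
    (h : Nonempty ((Scheme.Modules.pullback ((A.quotientBy u K hcov hG hsm hgc).baseChangeToProd D.hat f₁ a₁ ha₁)).obj
      (A.poincarePullbackBundle u K hK hcov hG hsm hgc D hfree).L ≅ L₁)) :
    Nonempty ((Scheme.Modules.pullback ((A.quotientBy u K hcov hG hsm hgc).baseChangeToProd
        (D.hat.quotientBy u K' hcov' hG' hsm' hgc') f₁
        (a₁ ≫ (show D.hat.X ⟶ (D.hat.quotientBy u K' hcov' hG' hsm' hgc').X from D.hat.quotientMk u K' hcov').left)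
        (by rw [Category.assoc, Over.w, ha₁]))).obj
        (A.poincareQuotRigid u K hK hcov hG hsm hgc D hfree K' hcov' hG' hsm' hgc' Φ) ≅ L₁) := by
  obtain ⟨i⟩ := h
  obtain ⟨ePB⟩ := A.nonempty_pullback_whiskerLeft_poincareQuotRigid_iso u K hK hcov hG hsm hgc D hfree K' hcov' hG' hsm' hgc' hfree' Φ
  obtain ⟨j⟩ := (A.quotientBy u K hcov hG hsm hgc).nonempty_pullback_baseChangeToProd_pullback_whiskerLeft_iso D.hat
    (D.hat.quotientBy u K' hcov' hG' hsm' hgc')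
    (show D.hat.X ⟶ (D.hat.quotientBy u K' hcov' hG' hsm' hgc').X from D.hat.quotientMk u K' hcov')
    (A.poincareQuotRigid u K hK hcov hG hsm hgc D hfree K' hcov' hG' hsm' hgc' Φ) f₁ a₁ ha₁
  exact ⟨j.symm ≪≫ (Scheme.Modules.pullback _).mapIso ePB ≪≫ i⟩

end Quotient

/-! ## §3 The discrepancy units of `e : ψ_{T₁}^* F₁ ≅ ψ_{T₁}^* F₀` and the open piece where they are `1` -/

section Units

variable {S : Scheme.{u}} (A : AbelianSchemeOver S)
  {Y : Scheme.{u}} (u : S ⟶ Y) (K : Subgroup A.Sections) {n : ℕ}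
  (hK : ∀ σ : K, (σ : A.Sections) ^ n = 1)
  [Finite K] [Y.IsSeparated] [IsSeparated (A.X.hom ≫ u)] [S.IsSeparated]
  (hcov : ∀ x : A.left, ∃ O : (A.translationActionOver u K).StableAffineOpens, x ∈ O.1)
  [LocallyOfFiniteType (A.X.hom ≫ u)] [IsLocallyNoetherian Y]
  (hG : ∃ _ : GrpObj (A.quotientOver u K), IsMonHom (A.quotientMk u K hcov))
  (hsm : Smooth (A.quotientOver u K).hom) (hgc : GeometricallyConnected (A.quotientOver u K).hom) [IsAffine Y]
  (hfree : ∀ (Ω : Type u) [Field Ω] [IsAlgClosed Ω] (x : Spec (.of Ω) ⟶ A.left) (σ : K), σ ≠ 1 →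
    x ≫ (A.translation (σ : A.Sections)).left ≠ x)
  (hSteinA : ∀ {T : Scheme.{u}} (f : T ⟶ S) (W : T.Opens), Function.Bijective ((A.baseChange f).X.hom.app W))

omit [IsAffine Y] in
include hK hSteinA in
/-- **THE DISCREPANCY UNITS.**  For an isomorphism `e : ψ_{T₁}^* F₁ ≅ ψ_{T₁}^* F₀` of the pull-backs of two modules on `B_{T₁}`
(`B := A/K`, `ψ_{T₁} = ψ ▷ T₁` the free `K`-quotient `A_{T₁} → B_{T₁}`, ★ (u0) `translationActionOverWhiskerRight`) with `F₀` a line bundle,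
there is a monoid homomorphism `v : K →* Γ(T₁, 𝒪_{T₁})` whose pull-backs `π^♯(v σ) ∈ Γ(A_{T₁}, 𝒪)` are the discrepancies of `e`
against the canonical `K`-linearisations, and `(v σ)ⁿ = 1` (generic `exists_hom_discrepancy_eq_appTop`: the scalars descend to `T₁` by
STEIN `Γ(A_{T₁}, 𝒪) = Γ(T₁, 𝒪)`, hypothesis `hSteinA`; `t_σ × 1` is a `T₁`-morphism; `K` is `n`-torsion).
[cite: MumfordAV1970, §12 Thm. 1 (p. 112), §15 Thm. 1 (p. 143)] [cite: MumfordFogartyKirwan1994, Ch. 1 §3 Definition 1.6 (p. 30)] -/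
theorem exists_discrepancy_hom {T₁ : Scheme.{u}} (f₁ : T₁ ⟶ S)
    (F₀ F₁ : ((A.quotientBy u K hcov hG hsm hgc).baseChange f₁).X.left.Modules) (h₀ : HasRank F₀ 1)
    (e : (Scheme.Modules.pullback (A.quotientMk u K hcov ▷ Over.mk f₁).left).obj F₁ ≅
      (Scheme.Modules.pullback (A.quotientMk u K hcov ▷ Over.mk f₁).left).obj F₀) :
    ∃ v : K →* Γ(T₁, ⊤), (∀ σ : K, v σ ^ n = 1) ∧ ∀ σ : K,
      (Scheme.Modules.pullback ((translationActionOverWhiskerRight A (Over.mk f₁) u K hcov).autHom σ)).map e.hom ≫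
          ((ActionOver.EquivariantStructure.ofPullback (translationActionOverWhiskerRight A (Over.mk f₁) u K hcov) F₀).iso σ).hom =
        ((ActionOver.EquivariantStructure.ofPullback (translationActionOverWhiskerRight A (Over.mk f₁) u K hcov) F₁).iso σ).hom ≫
          e.hom ≫ globalScalar _ ((A.baseChange f₁).X.hom.appTop (v σ)) :=
  ActionOver.exists_hom_discrepancy_eq_appTop (translationActionOverWhiskerRight A (Over.mk f₁) u K hcov)
    (A.baseChange f₁).X.hom (fun σ => A.whiskerRight_left_comp_baseChange_hom f₁ (A.translation ((σ : K) : A.Sections)))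
    (hSteinA f₁ ⊤) (fun σ => Subtype.ext (by rw [Subgroup.coe_pow, Subgroup.coe_one]; exact hK σ)) F₀ F₁
    (hasRank_pullback _ h₀) e

include hfree in
/-- **ON THE OPEN PIECE `G := D(∏_σ (1 + v_σ + ⋯ + v_σ^{n-1}))` OF `T₁` THE TWO MODULES AGREE.**  With `e`, `v` as in
`exists_discrepancy_hom` (`v` any function with the discrepancy property and `(v σ)ⁿ = 1`), both `Fᵢ` line bundles: on `G` every `v_σ`
restricts to `1` (`(v - 1)(1 + ⋯ + v^{n-1}) = vⁿ - 1 = 0` with the second factor a unit), so the restriction of `e` to `A_G` has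
discrepancies `1` along the equivariant square `A_G → A_{T₁}` over `B_G → B_{T₁}` and DESCENDS along the free quotient `ψ_G` (★ (u0);
generic `nonempty_pullback_iso_of_discrepancy_appTop_eq_one`): `F₁|_{B_G} ≅ F₀|_{B_G}`.
[cite: MumfordAV1970, §12 Thm. 1 (p. 112), §15 Thm. 1 (p. 143)] [cite: Greither1992CyclicGalois, Ch. 0 Prop. 7.2 (p. 29)] -/
theorem nonempty_pullback_prodMap_iso_on_basicOpen {T₁ : Scheme.{u}} (f₁ : T₁ ⟶ S)
    (F₀ F₁ : ((A.quotientBy u K hcov hG hsm hgc).baseChange f₁).X.left.Modules) (h₀ : HasRank F₀ 1) (h₁ : HasRank F₁ 1)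
    (e : (Scheme.Modules.pullback (A.quotientMk u K hcov ▷ Over.mk f₁).left).obj F₁ ≅
      (Scheme.Modules.pullback (A.quotientMk u K hcov ▷ Over.mk f₁).left).obj F₀)
    (v : K → Γ(T₁, ⊤)) (hvn : ∀ σ : K, v σ ^ n = 1)
    (hv : ∀ σ : K,
      (Scheme.Modules.pullback ((translationActionOverWhiskerRight A (Over.mk f₁) u K hcov).autHom σ)).map e.hom ≫
          ((ActionOver.EquivariantStructure.ofPullback (translationActionOverWhiskerRight A (Over.mk f₁) u K hcov) F₀).iso σ).hom =
        ((ActionOver.EquivariantStructure.ofPullback (translationActionOverWhiskerRight A (Over.mk f₁) u K hcov) F₁).iso σ).hom ≫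
          e.hom ≫ globalScalar _ ((A.baseChange f₁).X.hom.appTop (v σ)))
    (s : Γ(T₁, ⊤)) (hs : haveI := Fintype.ofFinite K; s = ∏ σ : K, ∑ i ∈ Finset.range n, v σ ^ i) :
    Nonempty ((Scheme.Modules.pullback ((A.quotientBy u K hcov hG hsm hgc).prodMap ((T₁.basicOpen s).ι ≫ f₁) f₁
        (T₁.basicOpen s).ι rfl)).obj F₁ ≅
      (Scheme.Modules.pullback ((A.quotientBy u K hcov hG hsm hgc).prodMap ((T₁.basicOpen s).ι ≫ f₁) f₁
        (T₁.basicOpen s).ι rfl)).obj F₀) := by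
  classical
  letI : Fintype K := Fintype.ofFinite K
  -- on `G` every `v σ` restricts to `1`
  have hvG : ∀ σ : K, (T₁.basicOpen s).ι.appTop (v σ) = 1 := by
    intro σ
    apply eq_one_of_pow_eq_one_of_isUnit_geomSum (n := n)
    · rw [← map_pow, hvn, map_one]
    · have hu : IsUnit ((T₁.basicOpen s).ι.appTop s) := isUnit_basicOpen_ι_appTop T₁ s
      have hs' : (T₁.basicOpen s).ι.appTop s = ∏ σ' : K, (T₁.basicOpen s).ι.appTop (∑ i ∈ Finset.range n, v σ' ^ i) := by
        simpa only [map_prod] using congrArg ((T₁.basicOpen s).ι.appTop) hs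
      rw [hs'] at hu
      have hdvd : (T₁.basicOpen s).ι.appTop (∑ i ∈ Finset.range n, v σ ^ i) ∣
          ∏ σ' : K, (T₁.basicOpen s).ι.appTop (∑ i ∈ Finset.range n, v σ' ^ i) :=
        Finset.dvd_prod_of_mem _ (Finset.mem_univ σ)
      have hu' := isUnit_of_dvd_unit hdvd hu
      simpa only [map_sum, map_pow] using hu'
  -- the discrepancies pull back to `1` along `A_G → A_{T₁}`
  have hr1 : ∀ σ : K, (A.prodMap ((T₁.basicOpen s).ι ≫ f₁) f₁ (T₁.basicOpen s).ι rfl).appTop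
      ((A.baseChange f₁).X.hom.appTop (v σ)) = 1 := by
    intro σ
    change ((A.baseChange f₁).X.hom.appTop ≫ (A.prodMap ((T₁.basicOpen s).ι ≫ f₁) f₁ (T₁.basicOpen s).ι rfl).appTop) (v σ) = 1
    rw [← Scheme.Hom.comp_appTop, A.prodMap_comp_baseChange_hom _ f₁ (T₁.basicOpen s).ι rfl, Scheme.Hom.comp_appTop,
      CommRingCat.comp_apply, hvG, map_one]
  -- descent along the free quotient `ψ_G : A_G → B_G`
  haveI : IsAffineHom (A.quotientMk u K hcov ▷ Over.mk ((T₁.basicOpen s).ι ≫ f₁)).left :=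
    isAffineHom_whiskerRight_quotientMk_left A (Over.mk ((T₁.basicOpen s).ι ≫ f₁)) u K hcov
  haveI : Flat (A.quotientMk u K hcov ▷ Over.mk ((T₁.basicOpen s).ι ≫ f₁)).left :=
    A.flat_whiskerRight_quotientMk_left (Over.mk ((T₁.basicOpen s).ι ≫ f₁)) u K hcov hfree
  exact ActionOver.nonempty_pullback_iso_of_discrepancy_appTop_eq_one
    (translationActionOverWhiskerRight A (Over.mk f₁) u K hcov)
    (translationActionOverWhiskerRight A (Over.mk ((T₁.basicOpen s).ι ≫ f₁)) u K hcov)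
    (A.prodMap ((T₁.basicOpen s).ι ≫ f₁) f₁ (T₁.basicOpen s).ι rfl)
    ((A.quotientBy u K hcov hG hsm hgc).prodMap ((T₁.basicOpen s).ι ≫ f₁) f₁ (T₁.basicOpen s).ι rfl)
    (A.whiskerRight_left_comp_prodMap (A.quotientBy u K hcov hG hsm hgc) ((T₁.basicOpen s).ι ≫ f₁) f₁ (T₁.basicOpen s).ι rfl
      (A.quotientMk u K hcov)).symm
    (fun σ => A.whiskerRight_left_comp_prodMap A ((T₁.basicOpen s).ι ≫ f₁) f₁ (T₁.basicOpen s).ι rfl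
      (A.translation ((σ : K) : A.Sections)))
    (isGeometricQuotient_translationActionOverWhiskerRight A (Over.mk ((T₁.basicOpen s).ι ≫ f₁)) u K hcov hfree)
    (translationActionOverWhiskerRight_free A (Over.mk ((T₁.basicOpen s).ι ≫ f₁)) u K hcov hfree)
    F₀ F₁ h₀ h₁ e (fun σ => (A.baseChange f₁).X.hom.appTop (v σ)) hv hr1

end Units

end AbelianSchemeOver

end Literature.AlgebraicGeometry.AbelianSchemes

end
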